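import Summits.CriticalPhenomena.PercolationContinuityZ3.Theorems.PercNearOneGluingNoHeavyPcintOneDefectBridgeInv
import Summits.CriticalPhenomena.PercolationContinuityZ3.Theorems.PercNearOneGluingNoHeavyPcintOneDefectEvalC
import Summits.CriticalPhenomena.PercolationContinuityZ3.Theorems.PercNearOneGluingNoHeavyPcintPolygonSubleadingLaw
import HarnessLib

/-!
# CriticalPhenomena/PercolationContinuityZ3 — Theorems/PercNearOneGluingNoHeavyPcintOneDefectClosedForm.lean: **STRUCTURE LAW C5-L4 IS A THEOREM FOR EVERY `m`** — `#defectSet (Fin 2m) = oneDefect m` and `polygonSubleadingCoeffLaw_holds`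

Lane prim-pcint, STRUCTURE rule «numerics ⇒ structure ⇒ conjecture» (prim-pcint-2 GEN 22).  The one-defect law for the SUB-LEADING coefficient of
the rooted oriented `2m`-gon count of `ℤ^d` (…PcintSubleadingChordLaw, `@[conjecture] polygonSubleadingCoeffLaw`: `[σ^{m−1}] 2·2m·p_2m(ℤ^d) =
b(m) − m(m−1)a(m)` with `b(m) = [x^{m−2}](5A'³ + U³A'(9H₃ − 7) + U⁴(3H₄ + 2))`), reduced by gen 21 (…PcintPolygonSubleadingLaw,
`polygonSubleadingCoeffLaw_iff`) to the COUNT `#defectSet (Fin 2m) = oneDefect m`, is proved here for all `m` by assembling the forest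
decomposition: one-defect structures are the top signed configurations of sign words `+−+−`, `++−−`, `+−−+` (…PcintOneDefectBridge/Inv and
`card_dSet_eq`), their generating functions were evaluated by the first-item / core-gap recursions (…PcintOneDefectEvalA–C), the sum of the three
values is `X⁴ · ev(5A'³ + U³A'(9H₃ − 7) + U⁴(3H₄ + 2))` (`top_sum_eq`), and the coefficient of `X^{2m}` is `oneDefectGF (m − 2)`
(…PcintSignedConfigEven).  Hence **`polygonSubleadingCoeffLaw_holds : polygonSubleadingCoeffLaw`** — together with gen 20's C5-L1
(`polygonLeadingCoeffLaw_holds`) the first two coefficients of the `1/(2d)` expansion of the `2m`-gon counts of `ℤ^d` are now closed-form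
theorems in the Touchard–Riordan numbers for every `m`.

HONEST FRAMING: a structure theorem about lattice polygon counts; no `p_c` cell depends on it.  No `sorry`; standard axioms.  Written by
prim-pcint-2 gen 22 (prover-prim-pcint-2-g22-0), 2026-08-27.
-/

open PowerSeries

namespace Summit.CriticalPhenomena.PercolationContinuityZ3.Theorems.Pcint.ChordDiag

open Summit.CriticalPhenomena.PercolationContinuityZ3.Theorems.Pcint.MemoryTail (connChord oneDefectGF oneDefect polygonSubleadingCoeffLaw
  polygonSubleadingCoeffLaw_iff)

variable {α : Type*} [LinearOrder α] [Fintype α]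

/-! ### The three sign words -/

/-- The top class is `IsCfg ∧ sw = S ∧ PropSAW`. [folklore] -/
theorem isGCfg_T_iff {S : List Bool} {c : Cfg α} : IsGCfg true [] none S c ↔ IsCfg c ∧ sw c = S ∧ PropSAW c := by
  unfold IsGCfg CondA CondB CondC
  simp

/-- Counting along a list with an indicator. [folklore] -/
theorem sum_map_ite_eq_countP {β : Type*} (p : β → Prop) [DecidablePred p] : ∀ l : List β,
    (l.map fun x => if p x then 1 else 0).sum = l.countP (fun x => decide (p x))
  | [] => by simp
  | x :: l => by
    rw [List.map_cons, List.sum_cons, List.countP_cons, sum_map_ite_eq_countP p l]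
    by_cases h : p x <;> simp [h]; omega

/-- The number of positive letters is the number of `true` in the sign word. [folklore] -/
theorem card_posL_eq_count (c : Cfg α) : (posL c).card = (sw c).count true := by
  classical
  symm
  unfold posL sw
  have hp : ((· == true) ∘ c.2) = fun x => decide (c.2 x = true) := by funext x; simp
  rw [List.count, List.countP_map, hp, ← sum_map_ite_eq_countP (fun x => c.2 x = true), ← List.sum_toFinset _ (Finset.sort_nodup _ _),
    Finset.sort_toFinset, Finset.card_filter]

/-- The sign word starts with the sign of the least letter. [folklore] -/
theorem sw_head (c : Cfg α) (h : (letters c).Nonempty) : (sw c).head? = some (c.2 ((letters c).min' h)) := by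
  unfold sw
  rw [List.head?_map, Finset.min'_eq_sorted_zero, List.head?_eq_getElem?, List.getElem?_eq_getElem]
  rfl

/-- The Boolean words of length four with two `true` starting with `true`. [folklore] -/
theorem word_cases (l : List Bool) (h4 : l.length = 4) (hc : l.count true = 2) (hh : l.head? = some true) :
    l = [true, false, true, false] ∨ l = [true, true, false, false] ∨ l = [true, false, false, true] := by
  match l, h4 with
  | [x, y, z, w], _ =>
    simp only [List.head?_cons, Option.some.injEq] at hh
    subst hh
    revert hc; revert y z w; decide

/-- **`dSet` is the union of the three top classes.** [folklore] -/
theorem mem_dSet_iff (c : Cfg α) : c ∈ dSet α ↔ c ∈ gSet true [] none [true, false, true, false] α ∨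
    c ∈ gSet true [] none [true, true, false, false] α ∨ c ∈ gSet true [] none [true, false, false, true] α := by
  rw [mem_dSet, mem_gSet, mem_gSet, mem_gSet, isGCfg_T_iff, isGCfg_T_iff, isGCfg_T_iff]
  constructor
  · rintro ⟨hc, hP, h4, h2, hmin⟩
    have hne : (letters c).Nonempty := Finset.card_pos.1 (by omega)
    have hlen : (sw c).length = 4 := by rw [length_sw, h4]
    have hcount : (sw c).count true = 2 := by rw [← card_posL_eq_count]; exact h2
    have hhead : (sw c).head? = some true := by
      rw [sw_head c hne, hmin _ (Finset.min'_mem _ _) fun y hy => Finset.min'_le _ _ hy]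
    rcases word_cases (sw c) hlen hcount hhead with h | h | h
    · exact Or.inl ⟨hc, h, hP⟩
    · exact Or.inr (Or.inl ⟨hc, h, hP⟩)
    · exact Or.inr (Or.inr ⟨hc, h, hP⟩)
  · intro h
    have key : ∀ S, S.length = 4 → S.count true = 2 → S.head? = some true → IsCfg c ∧ sw c = S ∧ PropSAW c → IsDCfg c := by
      rintro S h4 h2 hh ⟨hc, hsw, hP⟩
      have hL : (letters c).card = 4 := by rw [← length_sw, hsw, h4]
      have hne : (letters c).Nonempty := Finset.card_pos.1 (by omega)
      refine ⟨hc, hP, hL, by rw [show ((letters c).filter fun x => c.2 x = true) = posL c from rfl, card_posL_eq_count, hsw, h2],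
        fun x hx hmin => ?_⟩
      have hx : x = (letters c).min' hne := le_antisymm (hmin _ (Finset.min'_mem _ _)) (Finset.min'_le _ _ hx)
      have := sw_head c hne
      rw [hsw, hh, ← hx] at this
      exact (Option.some.inj this).symm
    rcases h with h | h | h
    · exact key _ rfl rfl rfl h
    · exact key _ rfl rfl rfl h
    · exact key _ rfl rfl rfl h

/-- **`#dSet = #T(+−+−) + #T(++−−) + #T(+−−+)`.** [folklore] -/
theorem card_dSet_eq : (dSet α).card = (gSet true [] none [true, false, true, false] α).card +
    (gSet true [] none [true, true, false, false] α).card + (gSet true [] none [true, false, false, true] α).card := by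
  have hdis : ∀ S S' : List Bool, S ≠ S' → Disjoint (gSet true [] none S α) (gSet true [] none S' α) := by
    intro S S' hne
    rw [Finset.disjoint_left]
    intro c h1 h2
    rw [mem_gSet] at h1 h2
    exact hne (h1.2.1.symm.trans h2.2.1)
  rw [← Finset.card_union_of_disjoint (hdis _ _ (by decide)), ← Finset.card_union_of_disjoint]
  · congr 1
    ext c
    rw [mem_dSet_iff, Finset.mem_union, Finset.mem_union, or_assoc]
  · rw [Finset.disjoint_union_left]
    exact ⟨hdis _ _ (by decide), hdis _ _ (by decide)⟩

/-! ### The closed form -/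

/-- **The three evaluated top series sum to `X⁴ · ev(closed form)`.** [folklore] -/
theorem top_sum_eq : gS true [] none [true, false, true, false] + gS true [] none [true, true, false, false] +
    gS true [] none [true, false, false, true] = X ^ 4 * ev closedFormX := by
  rw [gv_T_W_N_S1010, gv_T_W_N_S1100, gv_T_W_N_S1001, ev_closedFormX]
  ring

/-- **C5-L4c: the one-defect number in closed form**, `#defectSet (Fin (2(k+2))) = oneDefect (k+2)` for every `k`. [folklore] -/
theorem card_defectSet_eq_oneDefect (k : ℕ) : ((defectSet (Fin (2 * (k + 2)))).card : ℤ) = oneDefect (k + 2) := by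
  rw [card_defectSet_eq_card_dSet (⟨0, by omega⟩ : Fin (2 * (k + 2))), card_dSet_eq]
  change ((gCount true [] none [true, false, true, false] (2 * (k + 2)) + gCount true [] none [true, true, false, false] (2 * (k + 2)) +
    gCount true [] none [true, false, false, true] (2 * (k + 2)) : ℕ) : ℤ) = _
  push_cast
  rw [← coeff_gS, ← coeff_gS, ← coeff_gS, ← map_add, ← map_add, top_sum_eq, show 2 * (k + 2) = 2 * k + 4 by ring,
    PowerSeries.coeff_X_pow_mul, coeff_ev_closedFormX]
  unfold oneDefect
  simp

/-- **STRUCTURE LAW C5-L4 (P22) HOLDS FOR EVERY `m`**: the sub-leading coefficient of the rooted oriented `2m`-gon count of `ℤ^d` is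
`b(m) − m(m−1)a(m)` with `b(m) = [x^{m−2}](5A'³ + U³A'(9H₃ − 7) + U⁴(3H₄ + 2))` in the Touchard–Riordan numbers. [folklore] -/
theorem polygonSubleadingCoeffLaw_holds : polygonSubleadingCoeffLaw :=
  polygonSubleadingCoeffLaw_iff.2 card_defectSet_eq_oneDefect

end Summit.CriticalPhenomena.PercolationContinuityZ3.Theorems.Pcint.ChordDiag
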